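/-
Literature/Probability/FitznerVanDerHofstad2017/SrwWSplitHybrid.lean   (NEW, additive, d-generic)

b2b-lace lean1-g22, node N67-S2-K2d-H: the HYBRID (disjoint placements exact, overlapping placements by
product-Jensen) bound on the `W`-split far node `W_{n,j}(x) = ∫ D̂^{2j} Ĉⁿ [D̂^{(x)}]²` of [FvdH-NoBLE (5.16)].
What-if / input-certification lane: no statement about any dimension; the record (CERT REV 14) is untouched.
-/
import Literature.Probability.FitznerVanDerHofstad2017.SrwWSplitJensen
import HarnessLib

/-!
# The `W`-split far node: disjoint placements exact, overlapping placements by product-Jensen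

`SrwWSplitJensen.DhatSym_sq_le` bounds `[D̂^{(x)}]² = (d!)⁻² Σ_{ν,ν'} P_ν P_{ν'}` (`P_ν(k) = Π_j cos(x_{νj} k_j)`)
by Cauchy–Schwarz over ALL pairs of permutations.  Writing `ν' = σν`, the pair `(ν, σν)` places the support
`S = supp x` on the slot sets `ν⁻¹S` and `ν⁻¹σ⁻¹S`; when `σS ∩ S = ∅` these are disjoint and the product is EXACTLY
one coordinate product, `P_ν(x) P_ν(x∘σ) = P_ν(x + x∘σ)` (`cos 0 = 1` in every slot carrying only one of them),
whose symmetrised integral is the one-point integral `I_{n,2j}(x + x∘σ)` at a point of the DOUBLED CLASS (the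
multiset of `|x_i| ≠ 0` taken twice).  Only the overlapping relative permutations `σ` (`σS ∩ S ≠ ∅`, at most
`s²(d-1)!` of the `d!`) need the inequality `P_ν(x)P_ν(x∘σ) ≤ (P_ν(x)² + P_ν(x∘σ)²)/2` and `permProd_sq`:

* §1–§2 `DhatSym_sq_le_hybrid` (pointwise):
  `[D̂^{(x)}]² ≤ (d!)⁻¹ Σ_{σ : σS∩S=∅} D̂^{(x+x∘σ)} + (#{σ : σS∩S≠∅}/d!) · 2^{-s} Σ_{T⊆S} D̂^{(2x|_T)}`;
* §3 `srwW_le_hybrid` (integrated against `D̂^{2j} Ĉⁿ ≥ 0`, `2n+1 ≤ d`):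
  `W_{n,j}(x) ≤ (d!)⁻¹ Σ_{σS∩S=∅} I_{n,2j}(x + x∘σ) + (#{σS∩S≠∅}/d!) · J_{n,2j}(x)`;
* §4 `srwW_le_hybrid_cert`: for `0 ≤ α ≤ #{σS∩S=∅}/d!`, `I_{n,2j}(x+x∘σ) ≤ B_xx` on the disjoint `σ`, and
  `J_{n,2j}(x) ≤ B_J`:  `W_{n,j}(x) ≤ α B_xx + (1-α) max(B_xx, B_J)`;
* §5 the union bound `d · #{σS∩S≠∅} ≤ s² · d!` (`card_ovlPerms_mul_le`; every fibre `{σ | σ i = a}` has `(d-1)!`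
  elements), i.e. `#{σS∩S=∅}/d! ≥ 1 - s²/d` (`le_card_disPerms`);
* §6 the `K`-certificate through any `W`-majorant, `srwK_le_of_srwW_cert`
  (`A ≥ I_{n,2m}(0)`, `B ≥ W_{n,j}(x)`, `AB ≤ F²` ⟹ `K_{n,m+j}(x) ≤ F`).

For `s = 1` (`x = r e₁`) both steps are equalities given exact integrals: the bound is the orbit value
`W = [(d-1)/d]·I(r e₁ + r e₂) + (1/d)·[I(0) + I(2r e₁)]/2`.  All statements are `d`-generic; pointer language only.

References: [FvdH-NoBLE] R. Fitzner, R. van der Hofstad, "Generalized approach to the non-backtracking lace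
expansion", PTRF 169 (2017) 1041–1119, §3.5.3 (3.34)–(3.36), §5.1.2 (5.16); [FvdH17] —, "Mean-field behavior for
nearest-neighbor percolation in d > 10", EJP 22 (2017) no. 43, §4.2.
-/

namespace Literature.Probability.FitznerVanDerHofstad2017

open MeasureTheory Finset Real
open Literature.Barriers.CriticalPhenomena
open Literature.Barriers.CriticalPhenomena.Slade2006Prop53 (P)

variable {d : ℕ}

/-! ### §1. Relative permutations: disjoint and overlapping placements -/

/-- `x ∘ σ`: `(x∘σ)_i = x_{σ i}`. [cite: FitznerVanDerHofstad2016NoBLE, §3.5.3 (3.34) p. 1071] -/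
def compPerm (x : Fin d → ℤ) (σ : Equiv.Perm (Fin d)) : Fin d → ℤ := fun i => x (σ i)

/-- The relative permutations moving `S` off itself: `σ S ∩ S = ∅`.
[cite: FitznerVanDerHofstad2016NoBLE, §3.5.3 (3.34) p. 1071] -/
def disPerms (S : Finset (Fin d)) : Finset (Equiv.Perm (Fin d)) :=
  Finset.univ.filter fun σ => ∀ i ∈ S, σ i ∉ S

/-- The overlapping relative permutations: `σ S ∩ S ≠ ∅`. [cite: FitznerVanDerHofstad2016NoBLE, §3.5.3 (3.34) p. 1071] -/
def ovlPerms (S : Finset (Fin d)) : Finset (Equiv.Perm (Fin d)) :=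
  Finset.univ.filter fun σ => ¬ ∀ i ∈ S, σ i ∉ S

/-- `#dis + #ovl = d!`. [cite: FitznerVanDerHofstad2016NoBLE, §3.5.3 (3.34) p. 1071] -/
theorem card_disPerms_add_card_ovlPerms (S : Finset (Fin d)) :
    (disPerms S).card + (ovlPerms S).card = d.factorial := by
  rw [disPerms, ovlPerms, Finset.card_filter_add_card_filter_not, Finset.card_univ, Fintype.card_perm,
    Fintype.card_fin]

/-- `P_{σν}(x) = P_ν(x∘σ)`. [cite: FitznerVanDerHofstad2016NoBLE, §3.5.3 (3.34)–(3.35) p. 1071] -/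
theorem permProd_mul_left (x : Fin d → ℤ) (k : Fin d → ℝ) (σ ν : Equiv.Perm (Fin d)) :
    permProd x k (σ * ν) = permProd (compPerm x σ) k ν := by
  unfold permProd compPerm
  simp [Equiv.Perm.mul_apply]

/-- `Σ_ν P_ν(y) = d! · D̂^{(y)}`. [cite: FitznerVanDerHofstad2016NoBLE, §3.5.3 (3.35) p. 1071] -/
theorem sum_permProd_eq (y : Fin d → ℤ) (k : Fin d → ℝ) :
    ∑ ν : Equiv.Perm (Fin d), permProd y k ν = d.factorial * DhatSym d y k := by
  have hfac : (d.factorial : ℝ) ≠ 0 := by positivity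
  rw [DhatSym_eq_sum_permProd, mul_div_cancel₀ _ hfac]

/-- **Disjoint placements merge**: for `σ S ∩ S = ∅` (`S = supp x`),
`P_ν(x) · P_ν(x∘σ) = P_ν(x + x∘σ)` — in every slot at most one of the two factors is non-trivial.
[cite: FitznerVanDerHofstad2016NoBLE, §3.5.3 (3.34)–(3.35) p. 1071] -/
theorem permProd_mul_permProd_of_mem_disPerms {x : Fin d → ℤ} {σ : Equiv.Perm (Fin d)}
    (hσ : σ ∈ disPerms (nzSupp x)) (k : Fin d → ℝ) (ν : Equiv.Perm (Fin d)) :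
    permProd x k ν * permProd (compPerm x σ) k ν = permProd (x + compPerm x σ) k ν := by
  have hσ' := (Finset.mem_filter.1 hσ).2
  unfold permProd
  rw [← Finset.prod_mul_distrib]
  refine Finset.prod_congr rfl fun j _ => ?_
  simp only [Pi.add_apply, compPerm, Int.cast_add, add_mul]
  by_cases h : x (ν j) = 0
  · simp [h]
  · have hmem : ν j ∈ nzSupp x := by simp [nzSupp, h]
    have h2 : x (σ (ν j)) = 0 := by
      have := hσ' _ hmem
      simpa [nzSupp] using this
    simp [h2]

/-! ### §2. The pointwise hybrid bound -/

/-- `Σ_ν P_ν(x)² = d! · 2^{-s} Σ_{T⊆S} D̂^{(2x|_T)}` (`permProd_sq` summed over `ν`).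
[cite: FitznerVanDerHofstad2016NoBLE, §3.5.3 (3.35) p. 1071; §5.1.2 (5.16) p. 1092] -/
theorem sum_permProd_sq (x : Fin d → ℤ) (k : Fin d → ℝ) :
    ∑ ν : Equiv.Perm (Fin d), permProd x k ν ^ 2 =
      d.factorial * ((∑ T ∈ (nzSupp x).powerset, DhatSym d (dblOn x T) k) / 2 ^ (nzSupp x).card) := by
  simp_rw [permProd_sq]
  rw [← Finset.sum_div, Finset.sum_comm]
  simp_rw [sum_permProd_eq]
  rw [← Finset.mul_sum, mul_div_assoc]

/-- The overlap sum after a relative permutation is the plain square sum: `Σ_ν P_ν(x∘σ)² = Σ_ν P_ν(x)²`.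
[cite: FitznerVanDerHofstad2016NoBLE, §3.5.3 (3.34) p. 1071] -/
theorem sum_permProd_compPerm_sq (x : Fin d → ℤ) (k : Fin d → ℝ) (σ : Equiv.Perm (Fin d)) :
    ∑ ν : Equiv.Perm (Fin d), permProd (compPerm x σ) k ν ^ 2 = ∑ ν : Equiv.Perm (Fin d), permProd x k ν ^ 2 :=
  Fintype.sum_equiv (Equiv.mulLeft σ) _ _ fun ν => by
    simp [← permProd_mul_left]

/-- **The pointwise hybrid bound**: with `S = supp x`, `s = #S`,
`[D̂^{(x)}(k)]² ≤ (d!)⁻¹ Σ_{σ S ∩ S = ∅} D̂^{(x + x∘σ)}(k) + (#{σ S ∩ S ≠ ∅}/d!) · 2^{-s} Σ_{T ⊆ S} D̂^{(2x|_T)}(k)`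
(disjoint placements exact, `ab ≤ (a²+b²)/2` on the overlapping ones).
[cite: FitznerVanDerHofstad2016NoBLE, §3.5.3 (3.34)–(3.35) p. 1071; §5.1.2 (5.16) p. 1092] -/
theorem DhatSym_sq_le_hybrid (x : Fin d → ℤ) (k : Fin d → ℝ) :
    DhatSym d x k ^ 2 ≤ (∑ σ ∈ disPerms (nzSupp x), DhatSym d (x + compPerm x σ) k) / d.factorial +
      (ovlPerms (nzSupp x)).card / d.factorial *
        ((∑ T ∈ (nzSupp x).powerset, DhatSym d (dblOn x T) k) / 2 ^ (nzSupp x).card) := by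
  set S := nzSupp x with hS
  set Jpt := (∑ T ∈ S.powerset, DhatSym d (dblOn x T) k) / 2 ^ S.card with hJpt
  have hfac : (0 : ℝ) < d.factorial := by positivity
  -- the square of the permutation sum, re-indexed by the relative permutation
  have hsq : (∑ ν : Equiv.Perm (Fin d), permProd x k ν) ^ 2 =
      ∑ σ : Equiv.Perm (Fin d), ∑ ν : Equiv.Perm (Fin d), permProd x k ν * permProd (compPerm x σ) k ν := by
    rw [sq, Finset.sum_mul_sum, Finset.sum_comm]
    refine (Finset.sum_congr rfl fun ν _ => ?_).trans Finset.sum_comm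
    exact (Fintype.sum_equiv (Equiv.mulRight ν) _ _ fun σ => by
      simp [permProd_mul_left, mul_comm]).symm
  -- disjoint part: exact
  have hdis : ∑ σ ∈ disPerms S, ∑ ν : Equiv.Perm (Fin d), permProd x k ν * permProd (compPerm x σ) k ν =
      d.factorial * ∑ σ ∈ disPerms S, DhatSym d (x + compPerm x σ) k := by
    rw [Finset.mul_sum]
    refine Finset.sum_congr rfl fun σ hσ => ?_
    simp_rw [permProd_mul_permProd_of_mem_disPerms (hS ▸ hσ)]
    exact sum_permProd_eq _ _
  -- overlapping part: AM–GM and the square sum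
  have hovl : ∑ σ ∈ ovlPerms S, ∑ ν : Equiv.Perm (Fin d), permProd x k ν * permProd (compPerm x σ) k ν ≤
      (ovlPerms S).card * (d.factorial * Jpt) := by
    have hone : ∀ σ ∈ ovlPerms S,
        ∑ ν : Equiv.Perm (Fin d), permProd x k ν * permProd (compPerm x σ) k ν ≤ d.factorial * Jpt := by
      intro σ _
      calc ∑ ν : Equiv.Perm (Fin d), permProd x k ν * permProd (compPerm x σ) k ν
          ≤ ∑ ν : Equiv.Perm (Fin d), (permProd x k ν ^ 2 + permProd (compPerm x σ) k ν ^ 2) / 2 :=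
            Finset.sum_le_sum fun ν _ => by
              nlinarith [two_mul_le_add_sq (permProd x k ν) (permProd (compPerm x σ) k ν)]
        _ = ∑ ν : Equiv.Perm (Fin d), permProd x k ν ^ 2 := by
            rw [← Finset.sum_div, Finset.sum_add_distrib, sum_permProd_compPerm_sq]; ring
        _ = d.factorial * Jpt := by rw [hJpt, hS]; exact sum_permProd_sq x k
    calc ∑ σ ∈ ovlPerms S, ∑ ν : Equiv.Perm (Fin d), permProd x k ν * permProd (compPerm x σ) k ν
        ≤ ∑ σ ∈ ovlPerms S, (d.factorial : ℝ) * Jpt := Finset.sum_le_sum hone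
      _ = (ovlPerms S).card * (d.factorial * Jpt) := by rw [Finset.sum_const, nsmul_eq_mul]
  -- assemble
  have hsplit : ∑ σ : Equiv.Perm (Fin d), ∑ ν : Equiv.Perm (Fin d), permProd x k ν * permProd (compPerm x σ) k ν =
      (∑ σ ∈ disPerms S, ∑ ν : Equiv.Perm (Fin d), permProd x k ν * permProd (compPerm x σ) k ν) +
        ∑ σ ∈ ovlPerms S, ∑ ν : Equiv.Perm (Fin d), permProd x k ν * permProd (compPerm x σ) k ν := by
    rw [disPerms, ovlPerms, Finset.sum_filter_add_sum_filter_not]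
  rw [DhatSym_eq_sum_permProd, div_pow, hsq, hsplit, hdis]
  calc (↑d.factorial * ∑ σ ∈ disPerms S, DhatSym d (x + compPerm x σ) k +
          ∑ σ ∈ ovlPerms S, ∑ ν : Equiv.Perm (Fin d), permProd x k ν * permProd (compPerm x σ) k ν) /
          (d.factorial : ℝ) ^ 2
      ≤ (↑d.factorial * ∑ σ ∈ disPerms S, DhatSym d (x + compPerm x σ) k +
          (ovlPerms S).card * (d.factorial * Jpt)) / (d.factorial : ℝ) ^ 2 :=
        div_le_div_of_nonneg_right (add_le_add le_rfl hovl) (by positivity)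
    _ = (∑ σ ∈ disPerms S, DhatSym d (x + compPerm x σ) k) / d.factorial +
          (ovlPerms S).card / d.factorial * Jpt := by
        field_simp

/-! ### §3. Integration against `D̂^{2j} Ĉⁿ ≥ 0` -/

/-- **The hybrid majorant of `W`** (`2n+1 ≤ d`):
`W_{n,j}(x) ≤ (d!)⁻¹ Σ_{σ S ∩ S = ∅} I_{n,2j}(x + x∘σ) + (#{σ S ∩ S ≠ ∅}/d!) · J_{n,2j}(x)`.
[cite: FitznerVanDerHofstad2016NoBLE, §5.1.2 (5.16) p. 1092; §3.5.3 (3.34)–(3.35) p. 1071] -/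
theorem srwW_le_hybrid {n : ℕ} (hd : 2 * n + 1 ≤ d) (j : ℕ) (x : Fin d → ℤ) :
    srwW d n j x ≤ (∑ σ ∈ disPerms (nzSupp x), srwI d n (2 * j) (x + compPerm x σ)) / d.factorial +
      (ovlPerms (nzSupp x)).card / d.factorial * jensenSum d n (2 * j) x := by
  set S := nzSupp x with hS
  set c : ℝ := (ovlPerms S).card / d.factorial with hc
  have hc0 : 0 ≤ c := by positivity
  have hint : ∀ y : Fin d → ℤ,
      Integrable (fun k => (Dhat d k ^ (2 * j) * DhatSym d y k) * Chat d 1 k ^ n) (P d) :=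
    fun y => integrable_srwI_integrand hd (2 * j) y
  have hR : Integrable (fun k =>
      (∑ σ ∈ disPerms S, (Dhat d k ^ (2 * j) * DhatSym d (x + compPerm x σ) k) * Chat d 1 k ^ n) / d.factorial +
        c * ((∑ T ∈ S.powerset, (Dhat d k ^ (2 * j) * DhatSym d (dblOn x T) k) * Chat d 1 k ^ n) /
          2 ^ S.card)) (P d) :=
    ((integrable_finsetSum _ fun σ _ => hint _).div_const _).add
      (((integrable_finsetSum _ fun T _ => hint _).div_const _).const_mul c)
  have hmono : ∫ k, (Dhat d k ^ (2 * j) * DhatSym d x k ^ 2) * Chat d 1 k ^ n ∂P d ≤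
      ∫ k, (∑ σ ∈ disPerms S, (Dhat d k ^ (2 * j) * DhatSym d (x + compPerm x σ) k) * Chat d 1 k ^ n) /
          d.factorial +
        c * ((∑ T ∈ S.powerset, (Dhat d k ^ (2 * j) * DhatSym d (dblOn x T) k) * Chat d 1 k ^ n) /
          2 ^ S.card) ∂P d := by
    refine integral_mono_of_nonneg (ae_of_all _ fun k => ?_) hR (ae_of_all _ fun k => ?_)
    · exact mul_nonneg (mul_nonneg (by rw [pow_mul]; exact pow_nonneg (sq_nonneg _) j) (sq_nonneg _))
        (pow_nonneg (Chat_one_nonneg k) n)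
    · have hD : 0 ≤ Dhat d k ^ (2 * j) := by rw [pow_mul]; exact pow_nonneg (sq_nonneg _) j
      have hC : 0 ≤ Chat d 1 k ^ n := pow_nonneg (Chat_one_nonneg k) n
      have hpt := DhatSym_sq_le_hybrid x k
      calc (Dhat d k ^ (2 * j) * DhatSym d x k ^ 2) * Chat d 1 k ^ n
          ≤ (Dhat d k ^ (2 * j) * ((∑ σ ∈ disPerms S, DhatSym d (x + compPerm x σ) k) / d.factorial +
              c * ((∑ T ∈ S.powerset, DhatSym d (dblOn x T) k) / 2 ^ S.card))) * Chat d 1 k ^ n := by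
            gcongr
        _ = (∑ σ ∈ disPerms S, (Dhat d k ^ (2 * j) * DhatSym d (x + compPerm x σ) k) * Chat d 1 k ^ n) /
              d.factorial +
            c * ((∑ T ∈ S.powerset, (Dhat d k ^ (2 * j) * DhatSym d (dblOn x T) k) * Chat d 1 k ^ n) /
              2 ^ S.card) := by
            simp only [mul_add, add_mul, Finset.sum_div, Finset.mul_sum, Finset.sum_mul]
            congr 1 <;> exact Finset.sum_congr rfl fun _ _ => by ring
  have hRint : ∫ k, (∑ σ ∈ disPerms S, (Dhat d k ^ (2 * j) * DhatSym d (x + compPerm x σ) k) * Chat d 1 k ^ n) /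
        d.factorial +
      c * ((∑ T ∈ S.powerset, (Dhat d k ^ (2 * j) * DhatSym d (dblOn x T) k) * Chat d 1 k ^ n) / 2 ^ S.card) ∂P d =
      (∑ σ ∈ disPerms S, ∫ k, (Dhat d k ^ (2 * j) * DhatSym d (x + compPerm x σ) k) * Chat d 1 k ^ n ∂P d) /
        d.factorial +
      c * ((∑ T ∈ S.powerset, ∫ k, (Dhat d k ^ (2 * j) * DhatSym d (dblOn x T) k) * Chat d 1 k ^ n ∂P d) /
        2 ^ S.card) := by
    rw [integral_add ((integrable_finsetSum _ fun σ _ => hint _).div_const _)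
      (((integrable_finsetSum _ fun T _ => hint _).div_const _).const_mul c), integral_div,
      integral_finsetSum _ (fun σ _ => hint _), integral_const_mul, integral_div,
      integral_finsetSum _ (fun T _ => hint _)]
  unfold srwW jensenSum srwI
  calc (∫ k, (Dhat d k ^ (2 * j) * DhatSym d x k ^ 2) * Chat d 1 k ^ n ∂P d) / (2 * π) ^ d
      ≤ (∫ k, (∑ σ ∈ disPerms S, (Dhat d k ^ (2 * j) * DhatSym d (x + compPerm x σ) k) * Chat d 1 k ^ n) /
            d.factorial +
          c * ((∑ T ∈ S.powerset, (Dhat d k ^ (2 * j) * DhatSym d (dblOn x T) k) * Chat d 1 k ^ n) /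
            2 ^ S.card) ∂P d) / (2 * π) ^ d :=
        div_le_div_of_nonneg_right hmono (two_pi_pow_pos d).le
    _ = (∑ σ ∈ disPerms S, (∫ k, (Dhat d k ^ (2 * j) * DhatSym d (x + compPerm x σ) k) * Chat d 1 k ^ n ∂P d) /
            (2 * π) ^ d) / d.factorial +
          c * ((∑ T ∈ S.powerset, (∫ k, (Dhat d k ^ (2 * j) * DhatSym d (dblOn x T) k) * Chat d 1 k ^ n ∂P d) /
            (2 * π) ^ d) / 2 ^ S.card) := by
        rw [hRint, ← Finset.sum_div, ← Finset.sum_div]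
        ring

/-! ### §4. Uniformisation: one value for all disjoint placements -/

/-- **Hybrid certificate**: for any `α` with `α · d! ≤ #{σ S ∩ S = ∅}` (a negative `α` only weakens it), a common majorant `B_xx` of the
`I_{n,2j}(x + x∘σ)` over the disjoint `σ`, and `B_J ≥ J_{n,2j}(x)`:
`W_{n,j}(x) ≤ α B_xx + (1 - α) max(B_xx, B_J)` (`2n+1 ≤ d`).
[cite: FitznerVanDerHofstad2016NoBLE, §5.1.2 (5.16) p. 1092] -/
theorem srwW_le_hybrid_cert {n : ℕ} (hd : 2 * n + 1 ≤ d) (j : ℕ) (x : Fin d → ℤ) {α Bxx BJ : ℝ}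
    (hα : α * d.factorial ≤ (disPerms (nzSupp x)).card)
    (hxx : ∀ σ ∈ disPerms (nzSupp x), srwI d n (2 * j) (x + compPerm x σ) ≤ Bxx)
    (hJ : jensenSum d n (2 * j) x ≤ BJ) : srwW d n j x ≤ α * Bxx + (1 - α) * max Bxx BJ := by
  have hfac : (0 : ℝ) < d.factorial := by positivity
  set D := ((disPerms (nzSupp x)).card : ℝ) with hD
  set O := ((ovlPerms (nzSupp x)).card : ℝ) with hO
  have hDO : D + O = d.factorial := by
    rw [hD, hO]; exact_mod_cast card_disPerms_add_card_ovlPerms (nzSupp x)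
  have hO0 : 0 ≤ O := by rw [hO]; exact Nat.cast_nonneg _
  have h1 := srwW_le_hybrid hd j x
  have h2 : ∑ σ ∈ disPerms (nzSupp x), srwI d n (2 * j) (x + compPerm x σ) ≤ D * Bxx := by
    have := Finset.sum_le_card_nsmul _ _ _ hxx
    rwa [nsmul_eq_mul] at this
  have h3 : srwW d n j x ≤ D / d.factorial * Bxx + O / d.factorial * BJ := by
    refine h1.trans (add_le_add ?_ (mul_le_mul_of_nonneg_left hJ (by positivity)))
    rw [div_mul_eq_mul_div, mul_comm]
    exact div_le_div_of_nonneg_right (by rwa [mul_comm] at h2) hfac.le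
  have hα' : α ≤ D / d.factorial := by rwa [le_div_iff₀ hfac]
  have hO' : O / d.factorial = 1 - D / d.factorial := by
    field_simp
    linarith
  rw [hO'] at h3
  have hD1 : D / d.factorial ≤ 1 := by rw [div_le_one hfac]; linarith
  have hM1 : Bxx ≤ max Bxx BJ := le_max_left _ _
  have hM2 : BJ ≤ max Bxx BJ := le_max_right _ _
  have s1 : (1 - D / d.factorial) * BJ ≤ (1 - D / d.factorial) * max Bxx BJ :=
    mul_le_mul_of_nonneg_left hM2 (by linarith)
  have s2 : α * (max Bxx BJ - Bxx) ≤ D / d.factorial * (max Bxx BJ - Bxx) :=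
    mul_le_mul_of_nonneg_right hα' (by linarith)
  nlinarith [s1, s2, h3]

/-! ### §5. Counting the overlapping relative permutations -/

/-- All fibres `{σ | σ i = a}` have the same size. [cite: FitznerVanDerHofstad2016NoBLE, §3.5.3 (3.34) p. 1071] -/
theorem card_filter_perm_apply_eq (i a b : Fin d) :
    (Finset.univ.filter fun σ : Equiv.Perm (Fin d) => σ i = a).card =
      (Finset.univ.filter fun σ : Equiv.Perm (Fin d) => σ i = b).card := by
  refine Finset.card_bij' (fun σ _ => Equiv.swap a b * σ) (fun σ _ => Equiv.swap a b * σ) ?_ ?_ ?_ ?_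
  · intro σ hσ
    simp only [Finset.mem_filter, Finset.mem_univ, true_and] at hσ ⊢
    rw [Equiv.Perm.mul_apply, hσ, Equiv.swap_apply_left]
  · intro σ hσ
    simp only [Finset.mem_filter, Finset.mem_univ, true_and] at hσ ⊢
    rw [Equiv.Perm.mul_apply, hσ, Equiv.swap_apply_right]
  · intro σ _; exact Equiv.swap_mul_self_mul a b σ
  · intro σ _; exact Equiv.swap_mul_self_mul a b σ

/-- Every fibre has `(d-1)!` elements: `d · #{σ | σ i = a} = d!`. [cite: FitznerVanDerHofstad2016NoBLE, §3.5.3 (3.34) p. 1071] -/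
theorem card_filter_perm_apply_mul (i a : Fin d) :
    d * (Finset.univ.filter fun σ : Equiv.Perm (Fin d) => σ i = a).card = d.factorial := by
  have h := Finset.card_eq_sum_card_fiberwise (s := (Finset.univ : Finset (Equiv.Perm (Fin d))))
    (t := (Finset.univ : Finset (Fin d))) (f := fun σ => σ i) (fun _ _ => Finset.mem_univ _)
  rw [Finset.card_univ, Fintype.card_perm, Fintype.card_fin] at h
  rw [h, Finset.sum_congr rfl fun b _ => card_filter_perm_apply_eq i b a, Finset.sum_const, Finset.card_univ,
    Fintype.card_fin, smul_eq_mul]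

/-- **Union bound**: `d · #{σ : σS ∩ S ≠ ∅} ≤ s² · d!`. [cite: FitznerVanDerHofstad2016NoBLE, §3.5.3 (3.34) p. 1071] -/
theorem card_ovlPerms_mul_le (S : Finset (Fin d)) : d * (ovlPerms S).card ≤ S.card ^ 2 * d.factorial := by
  have hsub : ovlPerms S ⊆ S.biUnion fun i => S.biUnion fun a =>
      Finset.univ.filter fun σ : Equiv.Perm (Fin d) => σ i = a := by
    intro σ hσ
    simp only [ovlPerms, Finset.mem_filter, Finset.mem_univ, true_and, not_forall, not_not] at hσ
    obtain ⟨i, hi, hσi⟩ := hσ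
    simp only [Finset.mem_biUnion, Finset.mem_filter, Finset.mem_univ, true_and]
    exact ⟨i, hi, σ i, hσi, rfl⟩
  calc d * (ovlPerms S).card
      ≤ d * (S.biUnion fun i => S.biUnion fun a =>
          Finset.univ.filter fun σ : Equiv.Perm (Fin d) => σ i = a).card :=
        Nat.mul_le_mul_left _ (Finset.card_le_card hsub)
    _ ≤ d * ∑ i ∈ S, (S.biUnion fun a => Finset.univ.filter fun σ : Equiv.Perm (Fin d) => σ i = a).card :=
        Nat.mul_le_mul_left _ Finset.card_biUnion_le
    _ ≤ d * ∑ i ∈ S, ∑ a ∈ S, (Finset.univ.filter fun σ : Equiv.Perm (Fin d) => σ i = a).card := by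
        gcongr with i _
        exact Finset.card_biUnion_le
    _ = ∑ i ∈ S, ∑ a ∈ S, d * (Finset.univ.filter fun σ : Equiv.Perm (Fin d) => σ i = a).card := by
        rw [Finset.mul_sum]
        simp_rw [Finset.mul_sum]
    _ = ∑ i ∈ S, ∑ a ∈ S, d.factorial := by simp_rw [card_filter_perm_apply_mul]
    _ = S.card ^ 2 * d.factorial := by
        rw [Finset.sum_const, Finset.sum_const, smul_eq_mul, smul_eq_mul, sq, mul_assoc]

/-- **`#{σ S ∩ S = ∅}/d! ≥ 1 - s²/d`** (`d ≥ 1`), as the real inequality `(1 - s²/d)·d! ≤ #dis`.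
[cite: FitznerVanDerHofstad2016NoBLE, §3.5.3 (3.34) p. 1071] -/
theorem le_card_disPerms (S : Finset (Fin d)) (hd : 0 < d) :
    (1 - (S.card : ℝ) ^ 2 / d) * d.factorial ≤ (disPerms S).card := by
  have h1 : ((disPerms S).card : ℝ) + (ovlPerms S).card = d.factorial := by
    exact_mod_cast card_disPerms_add_card_ovlPerms S
  have h2 : (d : ℝ) * (ovlPerms S).card ≤ (S.card : ℝ) ^ 2 * d.factorial := by
    exact_mod_cast card_ovlPerms_mul_le S
  have hd' : (0 : ℝ) < d := by exact_mod_cast hd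
  have h3 : ((ovlPerms S).card : ℝ) ≤ (S.card : ℝ) ^ 2 * d.factorial / d := by
    rw [le_div_iff₀ hd']; linarith
  have h4 : (1 - (S.card : ℝ) ^ 2 / d) * d.factorial = d.factorial - (S.card : ℝ) ^ 2 * d.factorial / d := by
    field_simp
  rw [h4]
  linarith

/-! ### §6. The far node through any `W`-majorant -/

/-- **`K`-certificate through `W`**: `A ≥ I_{n,2m}(0)`, `B ≥ W_{n,j}(x)`, `0 ≤ F`, `AB ≤ F²` give
`K_{n,m+j}(x) ≤ F` (`2n+1 ≤ d`). [cite: FitznerVanDerHofstad2016NoBLE, §5.1.2 (5.16) p. 1092] -/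
theorem srwK_le_of_srwW_cert {n : ℕ} (hd : 2 * n + 1 ≤ d) {m j : ℕ} {x : Fin d → ℤ} {A B F : ℝ}
    (hA : srwI d n (2 * m) 0 ≤ A) (hB : srwW d n j x ≤ B) (hF : 0 ≤ F) (h : A * B ≤ F ^ 2) :
    srwK d n (m + j) x ≤ F := by
  have hI0 : 0 ≤ srwI d n (2 * m) 0 := srwI_zero_even_nonneg n m
  have hW0 : 0 ≤ srwW d n j x := srwW_nonneg n j x
  refine (srwK_le_sqrt_srwI_mul_srwW hd m j x).trans ?_
  rw [← Real.sqrt_mul hI0]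
  calc Real.sqrt (srwI d n (2 * m) 0 * srwW d n j x)
      ≤ Real.sqrt (A * B) := Real.sqrt_le_sqrt (mul_le_mul hA hB hW0 (hI0.trans hA))
    _ ≤ Real.sqrt (F ^ 2) := Real.sqrt_le_sqrt h
    _ = F := Real.sqrt_sq hF

/-! ### §7. Examples -/

/-- At `d = 3`, `S = {0}`: the two relative permutations fixing `0` overlap, the other four do not. -/
example : (disPerms ({0} : Finset (Fin 3))).card = 4 := by decide +kernel

/-- … and the union bound is attained for `s = 1`: `3 · 2 = 1² · 3!`. -/
example : 3 * (ovlPerms ({0} : Finset (Fin 3))).card = 1 ^ 2 * Nat.factorial 3 := by decide +kernel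

end Literature.Probability.FitznerVanDerHofstad2017
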